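import Summits.QuantumFields.BalabanUV.T4Continuum.Support.NE7CoarseCurlEnergyFlatSharp
import Summits.QuantumFields.BalabanUV.T4Continuum.Support.NE7MinActHessianFlatCurl
import Summits.QuantumFields.BalabanUV.T4Continuum.Support.AveragingDeficitMultiLevelBridge
import Summits.QuantumFields.BalabanUV.T4Continuum.Support.NE3LandauOrbit
import HarnessLib

/-!
# NE7EffectiveFormCoarseCurlAllLevels — THE `(j+1)`-STEP EFFECTIVE QUADRATIC FORM AT THE FLAT BACKGROUND DOMINATES THE COARSE MAXWELL FORM WITH CONSTANT ONE, UNIFORMLY IN THE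
# LEVEL `j`, THE VOLUME `N` AND THE COLOUR NUMBER `n`: `⟨v, Δ_{j+1} v⟩ ≥ w^{j+1} · Σ_{P ∈ perWin N} ‖curl_1 ṽ (P)‖²_{HS∕n}` (`d = 4`, `w = stepWt⁻¹ = 1`)

ROAD-G115 §11 (x)+(xi) of the lineage `b2b-balaban-t4-ne7-p1` (CRUX PROVER NE7 #1 = OWNER of BINDER row NE7), generation 116 — the successor items «all levels» and «volume-independent
constant» of the FIRST ESTIMATE on Bałaban's variational quadratic form, CLOSED.  WHAT ([folklore]; 0 def, 0 sorry):
* `stepWt_four` (`stepWt 4 L = 1`), `tower_window` (`L · tower L N j = N · L^{j+1}`).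
* **`effectiveForm_ge_coarse_curl_flat_allLevels`** (`L ≥ 2`, `0 < ε ≤ ε₀`, `N ≥ 1`, EVERY `j`, every `v ∈ skewSub N`):
  `w^{j+1} · Σ_{P ∈ perWin 4 N} nhsNormSq (curl_1 ṽ P) ≤ D²(minAct_{j+1} ∘ chart_1)(0)[v, v]`
  — ✓ `NE7MinActHessianFlatCurl.minAct_hessian_flat_curl` (`D²m(0)[v,v]` = the least element of `{w^{j+1}·Σ_p nhsNormSq(curl_1 X̃ p) : levelQ' j 1 X = v}`, attained at some `X⋆`) and
  ✓ `NE7CoarseCurlEnergyFlatSharp.coarse_curl_energy_levelQ'_flat_le` (`Σ_P nhsNormSq(curl_1 (levelQ' X⋆)̃ P) ≤ (L⁴∕L⁴)^{j+1}·Σ_p nhsNormSq(curl_1 X̃⋆ p)`).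
* `effectiveForm_ge_coarse_curl_flat_allLevels'` (the same without the weight: `Σ_P nhsNormSq(curl_1 ṽ P) ≤ D²m(0)[v,v]`, since `w = 1` in `d = 4`).
* **`effectiveForm_kernel_closed_flat_allLevels`**: `D²(minAct_{j+1} ∘ chart_1)(0)[v, v] = 0 ⟹ curl_1 ṽ ≡ 0` on the coarse period window — the null space of the `(j+1)`-step effective form at the
  flat datum consists of CLOSED fields, for EVERY `j` (gen 115's ✓ `NE7EffectiveFormKernelFlat` was `j = 0`).
SUPERSEDES ✓ `NE7CoarseCurlEnergyFlatQuant.effectiveForm_ge_coarse_curl_flat` (gen 115: one step, constant `w ∕ (1 + wallConst 4 L·√((LN)⁴·4·#planes)·4·card n)`) by the constant `w = 1`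
at every level.  Reading: at the flat background Bałaban's variational `Δ_{j+1}` (✓ p827954∕p828048) is bounded BELOW by the coarse lattice Maxwell form, with no loss, at every RG step —
the lattice shadow of «averaging does not increase the free action» at second order, now quantitative and uniform.
HONEST FRAMING: flat datum only; a LOWER bound transversal to closed fields (no upper bound, no gap on exact∕harmonic fields, closed ≠ exact unresolved); OUR minimisers (B11 (8) with
`sfClass`); nothing of Bałaban's asserted (context: [Balaban1985Averaging] (48) p. 25; [Balaban1984PropagatorsI]-type basic bounds are NOT claimed); NOT NE7 as a spine node; spine 0∕9;
NOT infinite volume, NOT mass gap, NOT BetaPertH, NOT Clay.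
-/

set_option autoImplicit false

open scoped BigOperators Matrix Matrix.Norms.L2Operator Topology
open NormedSpace Finset

namespace Summit.QuantumFields.BalabanUV.T4Continuum.NE7EffectiveFormCoarseCurlAllLevels

open Literature.MathematicalPhysics.QuantumFieldTheory.Balaban1983to89
open B7Prop1Explicit B7Prop2Explicit
open T4AveragingDeficitWall (curl)
open AveragingDeficitTorusChart (TDir chart chartDir)
open AveragingDeficitTwoLevelPrep (skewSub)
open AveragingDeficitMultiLevelPrep (tower levelQ' tower_ne_zero)
open AveragingDeficitMultiLevelBridge (tower_eq)
open MinimalActionLevels (perWin stepWt stepWt_pos)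
open MinimalActionSandwich (minAct)
open MinimalActionRate (sfClass)
open MinimalActionWitness (flatCfg)
open MatrixNorms (nhsNormSq nhsNormSq_nonneg)
open NE3LandauOrbit (eq_zero_of_nhsNormSq_eq_zero)
open NE7MinActHessianFlatCurl (minAct_hessian_flat_curl)
open NE7CoarseCurlEnergyFlatSharp (coarse_curl_energy_levelQ'_flat_le)

noncomputable section

variable {n : Type} [Fintype n] [DecidableEq n]

/-- In `d = 4` the per-step action weight is `1`. [folklore] -/
theorem stepWt_four (L : ℕ) : stepWt 4 L = 1 := by
  simp [stepWt]

/-- The base period of the `(j+1)`-level tower in the «`N·L^k`» form: `L · tower L N j = N · L^{j+1}`. [folklore] -/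
theorem tower_window (L N j : ℕ) : L * tower L N j = N * L ^ (j + 1) := by
  rw [tower_eq]
  ring

/-- **THE `(j+1)`-STEP EFFECTIVE QUADRATIC FORM AT THE FLAT BACKGROUND DOMINATES THE COARSE MAXWELL FORM, CONSTANT ONE, UNIFORMLY IN `j`, `N`, `n`** (`d = 4`, every `U(n)`, `L ≥ 2`):
`∃ ε₀ > 0, ∀ 0 < ε ≤ ε₀, ∀ N ≥ 1, ∀ j, ∀ v ∈ skewSub N, w^{j+1} · Σ_{P ∈ perWin 4 N} nhsNormSq (curl_1 ṽ P) ≤ D²(minAct 4 (sfClass 4 L N ε) L N (j+1) ∘ chart_1)(0)[v, v]`. [folklore] -/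
theorem effectiveForm_ge_coarse_curl_flat_allLevels [Nonempty n] {L : ℕ} [NeZero L] (hL : 2 ≤ L) :
    ∃ ε₀ : ℝ, 0 < ε₀ ∧ ∀ ε : ℝ, 0 < ε → ε ≤ ε₀ → ∀ (N : ℕ) [NeZero N], 1 ≤ N → ∀ (j : ℕ) (v : ↥(skewSub 4 n N)),
      ((stepWt 4 L)⁻¹) ^ (j + 1) * ∑ P ∈ perWin 4 N,
          nhsNormSq (curl (flatCfg : Site 4 → Fin 4 → (Matrix n n ℂ)ˣ) (chartDir (ContinuousLinearMap.id ℝ (Matrix n n ℂ)) N (v : TDir 4 n N)) P)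
        ≤ fderiv ℝ (fderiv ℝ (fun y : ↥(skewSub 4 n N) => minAct 4 (sfClass 4 L N ε) L N (j + 1)
            (chart (ContinuousLinearMap.id ℝ (Matrix n n ℂ)) N (flatCfg : Site 4 → Fin 4 → (Matrix n n ℂ)ˣ) (y : TDir 4 n N)))) 0 v v := by
  have hL1 : 1 ≤ L := by omega
  have hL0 : (L : ℝ) ≠ 0 := by exact_mod_cast (NeZero.ne L)
  obtain ⟨ε₀, hε₀, H⟩ := minAct_hessian_flat_curl (n := n) hL
  refine ⟨ε₀, hε₀, fun ε hε hεle N _ hN j v => ?_⟩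
  obtain ⟨-, hleast⟩ := H ε hε hεle N hN j
  obtain ⟨X, hXv, hval⟩ := (hleast v).1
  haveI : NeZero (L * tower L N j) := ⟨Nat.mul_ne_zero (NeZero.ne L) (tower_ne_zero L N j)⟩
  have hbound := coarse_curl_energy_levelQ'_flat_le (d := 4) (n := n) (L := L) (N := N) j (X : TDir 4 n (L * tower L N j)) X.2
  have hW : perWin 4 (L * tower L N j) = perWin 4 (N * L ^ (j + 1)) := by rw [tower_window]
  rw [hXv, hW, div_self (pow_ne_zero 4 hL0), one_pow, one_mul] at hbound
  rw [hval]
  exact mul_le_mul_of_nonneg_left hbound (pow_nonneg (inv_nonneg.mpr (stepWt_pos (d := 4) L hL1).le) _)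

/-- **The same without the weight** (`w = stepWt 4 L⁻¹ = 1`): `Σ_{P ∈ perWin 4 N} nhsNormSq (curl_1 ṽ P) ≤ D²(minAct_{j+1} ∘ chart_1)(0)[v, v]`, every `j`, `N`, `n`. [folklore] -/
theorem effectiveForm_ge_coarse_curl_flat_allLevels' [Nonempty n] {L : ℕ} [NeZero L] (hL : 2 ≤ L) :
    ∃ ε₀ : ℝ, 0 < ε₀ ∧ ∀ ε : ℝ, 0 < ε → ε ≤ ε₀ → ∀ (N : ℕ) [NeZero N], 1 ≤ N → ∀ (j : ℕ) (v : ↥(skewSub 4 n N)),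
      ∑ P ∈ perWin 4 N, nhsNormSq (curl (flatCfg : Site 4 → Fin 4 → (Matrix n n ℂ)ˣ) (chartDir (ContinuousLinearMap.id ℝ (Matrix n n ℂ)) N (v : TDir 4 n N)) P)
        ≤ fderiv ℝ (fderiv ℝ (fun y : ↥(skewSub 4 n N) => minAct 4 (sfClass 4 L N ε) L N (j + 1)
            (chart (ContinuousLinearMap.id ℝ (Matrix n n ℂ)) N (flatCfg : Site 4 → Fin 4 → (Matrix n n ℂ)ˣ) (y : TDir 4 n N)))) 0 v v := by
  obtain ⟨ε₀, hε₀, H⟩ := effectiveForm_ge_coarse_curl_flat_allLevels (n := n) hL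
  refine ⟨ε₀, hε₀, fun ε hε hεle N _ hN j v => ?_⟩
  have h := H ε hε hεle N hN j v
  rwa [stepWt_four, inv_one, one_pow, one_mul] at h

/-- **THE NULL SPACE OF THE `(j+1)`-STEP EFFECTIVE FORM AT THE FLAT DATUM CONSISTS OF CLOSED FIELDS, EVERY `j`**: `D²(minAct_{j+1} ∘ chart_1)(0)[v, v] = 0 ⟹ curl_1 ṽ (P) = 0` on every
plaquette of the coarse period window. [folklore] -/
theorem effectiveForm_kernel_closed_flat_allLevels [Nonempty n] {L : ℕ} [NeZero L] (hL : 2 ≤ L) :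
    ∃ ε₀ : ℝ, 0 < ε₀ ∧ ∀ ε : ℝ, 0 < ε → ε ≤ ε₀ → ∀ (N : ℕ) [NeZero N], 1 ≤ N → ∀ (j : ℕ) (v : ↥(skewSub 4 n N)),
      fderiv ℝ (fderiv ℝ (fun y : ↥(skewSub 4 n N) => minAct 4 (sfClass 4 L N ε) L N (j + 1)
        (chart (ContinuousLinearMap.id ℝ (Matrix n n ℂ)) N (flatCfg : Site 4 → Fin 4 → (Matrix n n ℂ)ˣ) (y : TDir 4 n N)))) 0 v v = 0 →
      ∀ P ∈ perWin 4 N, curl (flatCfg : Site 4 → Fin 4 → (Matrix n n ℂ)ˣ) (chartDir (ContinuousLinearMap.id ℝ (Matrix n n ℂ)) N (v : TDir 4 n N)) P = 0 := by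
  obtain ⟨ε₀, hε₀, H⟩ := effectiveForm_ge_coarse_curl_flat_allLevels' (n := n) hL
  refine ⟨ε₀, hε₀, fun ε hε hεle N _ hN j v hv0 P hP => ?_⟩
  have h := H ε hε hεle N hN j v
  rw [hv0] at h
  have hsum : ∑ P ∈ perWin 4 N, nhsNormSq (curl (flatCfg : Site 4 → Fin 4 → (Matrix n n ℂ)ˣ)
      (chartDir (ContinuousLinearMap.id ℝ (Matrix n n ℂ)) N (v : TDir 4 n N)) P) = 0 :=
    le_antisymm h (Finset.sum_nonneg fun P _ => nhsNormSq_nonneg _)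
  exact eq_zero_of_nhsNormSq_eq_zero ((Finset.sum_eq_zero_iff_of_nonneg fun P _ => nhsNormSq_nonneg _).mp hsum P hP)

end

end Summit.QuantumFields.BalabanUV.T4Continuum.NE7EffectiveFormCoarseCurlAllLevels
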